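import Literature.MathematicalPhysics.QuantumFieldTheory.Balaban1983to89.ClassLoopObservablesDenseOfProdConj
import HarnessLib

/-!
# ON `ℤ^{d+2}` THE CLASS-FUNCTION LOOP OBSERVABLES SPAN THE GAUGE-INVARIANT CYLINDER OBSERVABLES IF AND ONLY IF
# WORD-WISE CONJUGATE FINITE FAMILIES ARE SIMULTANEOUSLY CONJUGATE ([Levy2004] Thm 3.1 ⟺ Prop. 3.4, i.e. his
# Prop. 3.6 «Theorem (main) is logically equivalent to … Proposition 3.4», in class-function form, for every compact
# metrisable structure group)

statement-level skeleton of published theorems with citation tags; proofs where landed; nothing here is a claim about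
the Yang–Mills mass gap

Cell `lit-balaban`, unit p24 gen 22, file D of the own-lane free target (G.5-34(d); no SKELETON row).  [Levy2004]
Prop. 3.6 p.5 states: «Theorem (main) is logically equivalent to its specialization to the graphs L_r, r ≥ 1, which is
in turn equivalent to Proposition 3.4» — density of the loop observables ⟺ (word-wise conjugacy ⟹ simultaneous
conjugacy).  File C (`ClassLoopObservablesDenseOfProdConj`) proved «⟸» on `ℤ^d` for the class-function loop
observables (via Urysohn + Haar averaging and file A's orbit-Stone–Weierstrass); gen 20/21's negatives (p352515 for
`SO(8)`, p354549 for `SO(2m)`, `m ≥ 3`) are instances of «⟹».  THIS FILE proves BOTH DIRECTIONS for an arbitrary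
compact metrisable group `G`, giving the lineage's density census a single criterion:

* §1 the `r`-letter TEST CONFIGURATION `cfgN d V` on `ℤ^{d+2}` (`V k` on the loaded edge `e_k = ((2k+1)𝐞₁, 0)`,
  `1` elsewhere; gen 20's `loadedEdge`, `loopAt`): `hol_{ℓ_k}(cfgN V) = V k` (the lattice realisation of Lévy's bouquet
  `L_r`, [Levy2004] Example 2.2 ∕ Prop. 3.6);
* §2 **every loop holonomy of `cfgN V` is the value of a word in the letters `V k`** — the SAME word for every `V`
  (`reduceWord`: delete the unloaded darts, `wordVal_cfgN`); so if all words in `V`, `W` are conjugate, every loop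
  holonomy of `cfgN W` is conjugate to that of `cfgN V` and every element of `span_ℝ (classLoopProducts (d+2) G)` takes
  the same value on the two (`eq_on_cfgN_of_mem_span`);
* §3 **`exists_continuous_diagInvariant_apply_ne`: families NOT simultaneously conjugate are separated by a continuous
  function of `r` group elements invariant under simultaneous conjugation** (file C §1 for the diagonal action:
  closed orbit, Urysohn, Haar average `diagAverage`; [BrockerTomDieck1985] IV (2.12) Ex. 8 «X∕G is Hausdorff»);
* §4 the separating GAUGE-INVARIANT CYLINDER `sepFam Φ d U = Φ((hol_{ℓ_k} U)_k)` (support gen 20's `sepSupport`);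
* §5 **`not_spansGaugeInvariantCylinders_classLoopProducts_of_not_simConj`** («⟹», contrapositive: a word-wise
  conjugate, not simultaneously conjugate pair of families kills density on every `ℤ^{d+2}`; module XXIII's
  `not_spansGaugeInvariantCylinders_of_pointFunctional`), **`spansGaugeInvariantCylinders_classLoopProducts_of_wordConj`**
  («⟸», every `d`; file C's route with the word hypothesis), and the HEADLINE
  **`spansGaugeInvariantCylinders_classLoopProducts_iff`**: for a compact metrisable group `G`,
  `(∀ d, SpansGaugeInvariantCylinders (d+2) (classLoopProducts (d+2) G)) ⟺
   (∀ r (V W : Fin r → G), (∀ w, IsConj (w V) (w W)) → ∃ g, ∀ i, W i = g V i g⁻¹)`;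
  `ProdConjDetermined G` implies the right-hand side (`wordConj_of_prodConjDetermined`).

HONEST SCOPE.  Two lattice directions are used (`ℤ^{d+2}`); for `d + 2 ↦ 1` (the line) every gauge-invariant cylinder
is trivial and nothing is claimed.  `G` compact Hausdorff second countable.  The right-hand side is Lévy's Prop. 3.4 ∕
Sengupta's Thm 2 PROPERTY, decided in the tree group by group (true: `U(n)`, `SU(n)`, `O(n)`, `SO(2n+1)`, `SO(4)`,
abelian, products; false: `SO(2m)`, `m ≥ 3`); nothing about convergence at any `β`; NOT summit progress.

## References

* [Levy2004] T. Lévy, J. Geom. Phys. 52 (2004) 382–397 (arXiv:math-ph/0306059 pagination): §2 p.4 (Example 2.2 `L_r`,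
  Remark 2.4), Thm 3.1, Props 3.4, 3.5, 3.6 p.5 (quoted above).
* [Sengupta1994] A. Sengupta, Proc. AMS 121 (1994) 897–905, Thm 2 p.900.
* [BrockerTomDieck1985] GTM 98, IV (2.6), (2.12) Ex. 8 (p0156, p0160 of the held copy).
-/

noncomputable section

open MeasureTheory Filter Topology SimpleGraph
open scoped Matrix

namespace Literature.MathematicalPhysics.QuantumFieldTheory.Balaban1983to89.ClassLoopObservablesDenseIff

open Literature.MathematicalPhysics.QuantumLattice
open Literature.Probability.LatticeModels (zdGraph)
open Balaban1983to89.Missing (SpansGaugeInvariantCylinders)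
open ClassLoopObservablesNotDenseSO8 (classLoopProducts eq_of_mem_classLoopProducts walkHolonomy_eq_wordVal
  walkHolonomy_gaugeTransformZd loadedEdge loopAt sepSupport)
open ClassFunctionLoopObservablesDense (spansGaugeInvariantCylinders_classLoopProducts_of_separatesOrbits)
open ClassLoopObservablesDenseOfProdConj (ContClassFun classFam continuous_classFam classFam_conj
  exists_continuous_classFun_apply_ne)
open Literature.LinearAlgebra.Matrix (ProdConjDetermined)

universe u

/-! ## §1 The `r`-letter test configuration on `ℤ^{d+2}` -/

section Configurations

variable {d r : ℕ} {G : Type u} [Group G]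

/-- A straight walk in a direction along which the configuration is trivial has trivial holonomy. [folklore] -/
private theorem walkHolonomy_lineWalk_eq_one {U : LGConfig d G} {i : Fin d} (hU : ∀ z : (Fin d → ℤ), U (z, i) = 1) :
    ∀ (n : ℕ) (x : (Fin d → ℤ)), walkHolonomy U (lineWalk i n x) = 1
  | 0, x => by simp [lineWalk]
  | n + 1, x => by
    rw [lineWalk, walkHolonomy_cons, walkHolonomy_copy, dartHolonomy_add_single, hU, one_mul,
      walkHolonomy_lineWalk_eq_one hU n]

/-- The holonomy of a rectangle is the product of its four sides. [folklore] -/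
private theorem walkHolonomy_rectWalk (U : LGConfig d G) (x : (Fin d → ℤ)) (i j : Fin d) (R T : ℕ) :
    walkHolonomy U (rectWalk x i j R T) =
      walkHolonomy U (lineWalk i R x) * walkHolonomy U (lineWalk j T (x + Pi.single i (R : ℤ))) *
        (walkHolonomy U (lineWalk i R (x + Pi.single j (T : ℤ))))⁻¹ * (walkHolonomy U (lineWalk j T x))⁻¹ := by
  simp only [rectWalk, walkHolonomy_append, walkHolonomy_copy, walkHolonomy_reverse, mul_assoc]

/-- The loaded edges `e_k`, `k < r`, are pairwise distinct. [folklore] -/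
private theorem loadedEdge_fin_injective : Function.Injective fun k : Fin r => loadedEdge d k := by
  intro k l h
  have h1 := congrArg (fun e : ZdEdge (d + 2) => e.1 1) h
  simp only [loadedEdge, Pi.single_eq_same] at h1
  exact Fin.ext (by omega)

variable (d)

/-- **THE `r`-LETTER TEST CONFIGURATION** of a family `V : Fin r → G`: `V k` on the loaded edge
`e_k = ((2k+1)·𝐞₁, direction 0)`, `1` elsewhere — the lattice gauge field on `ℤ^{d+2}` realising Lévy's bouquet `L_r`
by the `r` based rectangles `ℓ_k` (gen 20's `loopAt`). [cite: Levy2004, §2 p.4 (Example 2.2, the graph L_r) and Prop 3.6 p.5] -/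
def cfgN (V : Fin r → G) : LGConfig (d + 2) G := Function.extend (fun k : Fin r => loadedEdge d k) V 1

variable {d}

/-- On the loaded edge `e_k` the configuration is `V k`. [cite: Levy2004, §2 p.4 (Example 2.2)] -/
theorem cfgN_loadedEdge (V : Fin r → G) (k : Fin r) : cfgN d V (loadedEdge d k) = V k :=
  loadedEdge_fin_injective.extend_apply _ _ k

/-- Off the loaded edges the configuration is `1`. [cite: Levy2004, §2 p.4 (Example 2.2)] -/
theorem cfgN_of_not_exists (V : Fin r → G) {e : ZdEdge (d + 2)} (he : ¬ ∃ k : Fin r, loadedEdge d k = e) :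
    cfgN d V e = 1 := by
  rw [cfgN, Function.extend_apply' _ _ _ he]
  rfl

/-- Off direction `0` the configuration is `1`. [cite: Levy2004, §2 p.4 (Example 2.2)] -/
private theorem cfgN_of_snd_ne (V : Fin r → G) {e : ZdEdge (d + 2)} (he : e.2 ≠ 0) : cfgN d V e = 1 :=
  cfgN_of_not_exists V (by rintro ⟨k, hk⟩; exact he (by rw [← hk]; rfl))

/-- The edge at the origin in direction `0` is unloaded. [folklore] -/
private theorem cfgN_origin (V : Fin r → G) : cfgN d V ((0 : (Fin (d + 2) → ℤ)), (0 : Fin (d + 2))) = 1 :=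
  cfgN_of_not_exists V (by
    rintro ⟨k, hk⟩
    have h1 : ((2 * (k : ℕ) + 1 : ℕ) : ℤ) = 0 := by
      simpa [loadedEdge] using congrArg (fun e : ZdEdge (d + 2) => e.1 1) hk
    omega)

/-- `(1 : Fin (d+2)) ≠ 0`. [folklore] -/
private theorem one_ne_zero_fin : (1 : Fin (d + 2)) ≠ 0 := by simp

/-- **THE HOLONOMY OF THE BASED RECTANGLE `ℓ_k` AT THE TEST CONFIGURATION IS THE `k`-TH LETTER** (the other three
direction-`0` edges of `ℓ_k` and all direction-`1` edges are unloaded). [cite: Levy2004, §2 p.4 (h_l as the ordered product of the edge variables)] -/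
theorem walkHolonomy_loopAt_cfgN (V : Fin r → G) (k : Fin r) : walkHolonomy (cfgN d V) (loopAt d k) = V k := by
  have h1 : ∀ z : (Fin (d + 2) → ℤ), cfgN d V (z, 1) = 1 := fun z => cfgN_of_snd_ne V (e := (z, 1)) one_ne_zero_fin
  rw [loopAt, walkHolonomy_rectWalk, walkHolonomy_lineWalk_eq_one h1, walkHolonomy_lineWalk_eq_one h1,
    walkHolonomy_lineWalk_one, walkHolonomy_lineWalk_one, zero_add, cfgN_origin, inv_one, one_mul, mul_one, mul_one]
  exact cfgN_loadedEdge V k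

end Configurations

/-! ## §2 Every loop holonomy of the test configuration is a word in the letters — the same word for every family -/

section Words

variable {d r : ℕ} {G : Type u} [Group G]

open Classical in
/-- The letter of `Fin r` under a lattice letter: `(k, ±)` if the edge is the loaded edge `e_k`, nothing otherwise.
[cite: Levy2004, Example 3.3 p.5 (loops in L_r ↔ words in e_1^{±1}, …, e_r^{±1})] -/
def reduceLetter (d r : ℕ) (a : ZdEdge (d + 2) × Bool) : Option (Fin r × Bool) :=
  if h : ∃ k : Fin r, loadedEdge d k = a.1 then some (h.choose, a.2) else none

/-- The word in the letters `k^{±1}`, `k < r`, under a lattice word: delete the unloaded letters.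
[cite: Levy2004, Example 3.3 p.5] -/
def reduceWord (d r : ℕ) (L : List (ZdEdge (d + 2) × Bool)) : List (Fin r × Bool) := L.filterMap (reduceLetter d r)

/-- A loaded lattice letter evaluates at `cfgN V` to the corresponding letter of `V`. [cite: Levy2004, Example 3.3 p.5] -/
private theorem letterVal_cfgN_of_exists (V : Fin r → G) {a : ZdEdge (d + 2) × Bool} (h : ∃ k : Fin r, loadedEdge d k = a.1) :
    letterVal (cfgN d V) a = letterVal V (h.choose, a.2) := by
  have he : cfgN d V a.1 = V h.choose := by
    have h' := cfgN_loadedEdge (d := d) V h.choose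
    rw [h.choose_spec] at h'
    exact h'
  rcases a with ⟨e, _ | _⟩ <;> simp [letterVal, he]

/-- An unloaded lattice letter evaluates at `cfgN V` to `1`. [cite: Levy2004, Example 3.3 p.5] -/
private theorem letterVal_cfgN_of_not_exists (V : Fin r → G) {a : ZdEdge (d + 2) × Bool}
    (h : ¬ ∃ k : Fin r, loadedEdge d k = a.1) : letterVal (cfgN d V) a = 1 := by
  have he : cfgN d V a.1 = 1 := cfgN_of_not_exists V h
  rcases a with ⟨e, _ | _⟩ <;> simp [letterVal, he]

/-- **A LATTICE WORD EVALUATED AT THE TEST CONFIGURATION IS THE REDUCED WORD EVALUATED AT THE FAMILY** — the same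
reduced word for every family `V`. [cite: Levy2004, Example 3.3 p.5 («if a loop l corresponds to a word w, then h_l(g) = w(g) for all g»)] -/
theorem wordVal_cfgN (V : Fin r → G) :
    ∀ L : List (ZdEdge (d + 2) × Bool), wordVal L (cfgN d V) = wordVal (reduceWord d r L) V
  | [] => by simp [reduceWord]
  | a :: L => by
    classical
    rw [wordVal_cons, wordVal_cfgN V L]
    simp only [reduceWord, List.filterMap_cons]
    by_cases h : ∃ k : Fin r, loadedEdge d k = a.1
    · simp only [reduceLetter, dif_pos h, wordVal_cons, letterVal_cfgN_of_exists V h]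
    · simp only [reduceLetter, dif_neg h, letterVal_cfgN_of_not_exists V h, one_mul]

/-- Hence **every walk holonomy of `cfgN V` is a word in `V`**, the same word for every `V`.
[cite: Levy2004, Example 3.3 p.5] -/
theorem walkHolonomy_cfgN (V : Fin r → G) {x y : (Fin (d + 2) → ℤ)} (w : (zdGraph (d + 2)).Walk x y) :
    walkHolonomy (cfgN d V) w = wordVal (reduceWord d r (w.darts.map dartStep)) V := by
  rw [walkHolonomy_eq_wordVal, wordVal_cfgN]

/-- **WORD-WISE CONJUGATE FAMILIES GIVE LOOP-WISE CONJUGATE CONFIGURATIONS**: if `w(V)` and `w(W)` are conjugate for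
every word `w`, every loop (indeed walk) holonomy of `cfgN W` is conjugate to that of `cfgN V`.
[cite: Levy2004, Prop 3.4 p.5 (hypothesis) and proof of Prop 3.6] -/
theorem exists_walkHolonomy_cfgN_conj {V W : Fin r → G}
    (hconj : ∀ w : List (Fin r × Bool), IsConj (wordVal w V) (wordVal w W)) {x y : (Fin (d + 2) → ℤ)}
    (w : (zdGraph (d + 2)).Walk x y) :
    ∃ g : G, walkHolonomy (cfgN d W) w = g * walkHolonomy (cfgN d V) w * g⁻¹ := by
  rw [walkHolonomy_cfgN, walkHolonomy_cfgN]
  obtain ⟨c, hc⟩ := isConj_iff.1 (hconj (reduceWord d r (w.darts.map dartStep)))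
  exact ⟨c, hc.symm⟩

/-- … so every class-function loop product takes the SAME value on `cfgN V` and `cfgN W` … [cite: Levy2004, §2 p.4 and Remark 2.4] -/
theorem eq_on_cfgN {V W : Fin r → G} (hconj : ∀ w : List (Fin r × Bool), IsConj (wordVal w V) (wordVal w W))
    {F : LGConfig (d + 2) G → ℝ} (hF : F ∈ classLoopProducts (d + 2) G) : F (cfgN d V) = F (cfgN d W) :=
  eq_of_mem_classLoopProducts hF fun _ w => exists_walkHolonomy_cfgN_conj hconj w

/-- … and so does every element of their real span. [cite: Levy2004, Thm 3.1 p.5 (the algebra generated by the loop observables)] -/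
theorem eq_on_cfgN_of_mem_span {V W : Fin r → G} (hconj : ∀ w : List (Fin r × Bool), IsConj (wordVal w V) (wordVal w W))
    {F : LGConfig (d + 2) G → ℝ} (hF : F ∈ Submodule.span ℝ (classLoopProducts (d + 2) G)) :
    F (cfgN d V) = F (cfgN d W) := by
  induction hF using Submodule.span_induction with
  | mem F hF => exact eq_on_cfgN hconj hF
  | zero => rfl
  | add F₁ F₂ _ _ h₁ h₂ => simp [h₁, h₂]
  | smul c F _ h => simp [h]

end Words

/-! ## §3 Families not simultaneously conjugate are separated by a continuous diagonal-conjugation-invariant function -/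

section DiagonalSeparation

variable {G : Type u} [Group G] [TopologicalSpace G] [IsTopologicalGroup G] [CompactSpace G] [T2Space G] {ι : Type}

/-- A simultaneous-conjugation orbit in `G^ι` is closed (a continuous image of the compact group).
[cite: BrockerTomDieck1985, IV (2.12) Ex. 8 (X/G Hausdorff for a compact G acting on a Hausdorff X; p0160)] -/
theorem isClosed_range_diagConj (V : ι → G) : IsClosed (Set.range fun g : G => fun i => g * V i * g⁻¹) :=
  (isCompact_range (continuous_pi fun _ => (continuous_id.mul continuous_const).mul continuous_id.inv)).isClosed

variable [MeasurableSpace G] [BorelSpace G]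

/-- THE HAAR AVERAGE over simultaneous conjugation: `diagAverage u H = ∫ u((g⁻¹ H_i g)_i) dg`.
[cite: BrockerTomDieck1985, IV (2.12) Ex. 8 (p0160)] -/
def diagAverage (u : (ι → G) → ℝ) (H : ι → G) : ℝ := ∫ g, u (fun i => g⁻¹ * H i * g) ∂Measure.haar

variable [SecondCountableTopology G] [Fintype ι] in
/-- The diagonal Haar average of a continuous function is continuous. [cite: BrockerTomDieck1985, IV (2.12) Ex. 8 (p0160)] -/
theorem continuous_diagAverage {u : (ι → G) → ℝ} (hu : Continuous u) : Continuous (diagAverage u) := by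
  have hj : Continuous fun p : (ι → G) × G => fun i => p.2⁻¹ * p.1 i * p.2 :=
    continuous_pi fun i => (continuous_snd.inv.mul ((continuous_apply i).comp continuous_fst)).mul continuous_snd
  have h := continuous_parametric_integral_of_continuous (μ := (Measure.haar : Measure G))
    (f := fun (H : ι → G) (g : G) => u (fun i => g⁻¹ * H i * g)) (hu.comp hj) isCompact_univ
  unfold diagAverage
  simpa only [Measure.restrict_univ] using h

/-- The diagonal Haar average is invariant under simultaneous conjugation (left invariance of Haar measure).
[cite: BrockerTomDieck1985, IV (2.12) Ex. 8 (p0160)] -/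
theorem diagAverage_conj (u : (ι → G) → ℝ) (H : ι → G) (h : G) :
    diagAverage u (fun i => h * H i * h⁻¹) = diagAverage u H := by
  unfold diagAverage
  rw [← integral_mul_left_eq_self (μ := (Measure.haar : Measure G)) (fun g => u (fun i => g⁻¹ * H i * g)) h⁻¹]
  congr 1
  funext g
  simp only [mul_inv_rev, inv_inv, mul_assoc]

/-- The diagonal Haar average of a function vanishing on the orbit of `V` vanishes at `V`.
[cite: BrockerTomDieck1985, IV (2.12) Ex. 8 (p0160)] -/
theorem diagAverage_eq_zero {u : (ι → G) → ℝ} {V : ι → G}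
    (hu : Set.EqOn u 0 (Set.range fun g : G => fun i => g * V i * g⁻¹)) : diagAverage u V = 0 := by
  unfold diagAverage
  have h0 : ∀ g : G, u (fun i => g⁻¹ * V i * g) = 0 := fun g => by
    have := hu ⟨g⁻¹, rfl⟩
    simpa only [inv_inv, Pi.zero_apply] using this
  simp only [h0, integral_zero]

/-- The diagonal Haar average of a non-negative continuous function not vanishing at `W` is positive at `W`.
[cite: BrockerTomDieck1985, IV (2.12) Ex. 8 (p0160)] -/
theorem diagAverage_pos [Fintype ι] {u : (ι → G) → ℝ} (hu : Continuous u) (h0 : 0 ≤ u) {W : ι → G} (hW : u W ≠ 0) :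
    0 < diagAverage u W := by
  unfold diagAverage
  have hj : Continuous fun g : G => fun i => g⁻¹ * W i * g :=
    continuous_pi fun i => (continuous_id.inv.mul continuous_const).mul continuous_id
  refine Continuous.integral_pos_of_hasCompactSupport_nonneg_nonzero (x := (1 : G)) (hu.comp hj)
    (HasCompactSupport.of_compactSpace _) (fun g => h0 (fun i => g⁻¹ * W i * g)) ?_
  simpa using hW

variable [SecondCountableTopology G] [Fintype ι] in
/-- **FAMILIES THAT ARE NOT SIMULTANEOUSLY CONJUGATE ARE SEPARATED BY A CONTINUOUS FUNCTION OF `ι`-MANY GROUP ELEMENTS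
INVARIANT UNDER SIMULTANEOUS CONJUGATION** (the orbit space `G^ι / G` is compact Hausdorff: Urysohn between the closed
orbit of `V` and `{W}`, then the diagonal Haar average). [cite: BrockerTomDieck1985, IV (2.12) Ex. 8 (p0160); Levy2004, §2 p.4 (Example 2.2: the points of the configuration space of L_r are the diagonal conjugacy classes of G^r)] -/
theorem exists_continuous_diagInvariant_apply_ne {V W : ι → G} (hVW : ¬ ∃ g : G, ∀ i, W i = g * V i * g⁻¹) :
    ∃ Φ : (ι → G) → ℝ, Continuous Φ ∧ (∀ (H : ι → G) (g : G), Φ (fun i => g * H i * g⁻¹) = Φ H) ∧ Φ V ≠ Φ W := by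
  have hSc : IsClosed (Set.range fun g : G => fun i => g * V i * g⁻¹) := isClosed_range_diagConj V
  have hWS : W ∉ Set.range fun g : G => fun i => g * V i * g⁻¹ := by
    rintro ⟨g, hg⟩
    exact hVW ⟨g, fun i => (congr_fun hg i).symm⟩
  obtain ⟨u, hu0, hu1, hu01⟩ := exists_continuous_zero_one_of_isClosed hSc isClosed_singleton
    (Set.disjoint_singleton_right.2 hWS)
  refine ⟨diagAverage u, continuous_diagAverage u.continuous, fun H g => diagAverage_conj u H g, ?_⟩
  have hV : diagAverage u V = 0 := diagAverage_eq_zero hu0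
  have hW : 0 < diagAverage u W :=
    diagAverage_pos u.continuous (fun x => (hu01 x).1) (by rw [hu1 rfl]; simp)
  rw [hV]
  exact hW.ne

end DiagonalSeparation

/-! ## §4 The separating gauge-invariant cylinder observable `U ↦ Φ((hol_{ℓ_k} U)_k)` -/

section Separating

variable {d r : ℕ} {G : Type u} [Group G] (Φ : (Fin r → G) → ℝ)

/-- `sepFam Φ d U = Φ((hol_{ℓ_k}(U))_{k<r})` — a function of the holonomies of the `r` based rectangles (Lévy's
`f ∘ (h_{l_1}, …, h_{l_n})`). [cite: Levy2004, Remark 2.4 p.4] -/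
def sepFam (d : ℕ) (U : LGConfig (d + 2) G) : ℝ := Φ fun k => walkHolonomy U (loopAt d k)

/-- At the test configuration, `sepFam Φ (cfgN V) = Φ V`. [cite: Levy2004, Remark 2.4 p.4] -/
theorem sepFam_cfgN (V : Fin r → G) : sepFam Φ d (cfgN d V) = Φ V := by
  simp only [sepFam, walkHolonomy_loopAt_cfgN]

/-- `sepFam Φ` is a cylinder observable supported on the edges of the loops `ℓ_k` (gen 20's `sepSupport`).
[cite: Levy2004, Remark 2.4 p.4] -/
theorem isCylinder_sepFam : IsCylinder (sepFam Φ d) (sepSupport d r) := by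
  intro U U' hUU'
  unfold sepFam
  congr 1
  funext k
  refine walkHolonomy_congr _ fun e he => hUU' _ ?_
  simp only [sepSupport, Finset.coe_biUnion, Finset.coe_univ, Set.mem_univ, Set.iUnion_true, Set.mem_iUnion,
    List.coe_toFinset, Set.mem_setOf_eq, List.mem_map]
  exact ⟨k, e, he, rfl⟩

/-- `sepFam Φ` is gauge invariant when `Φ` is invariant under simultaneous conjugation (all `ℓ_k` are based at the
origin, where a gauge transformation conjugates every holonomy by the same `g(0)`).
[cite: Levy2004, §2 p.4 («the action of φ ∈ G^V on G^E conjugates h_l by φ_{s(e_1)}^{-1}») and Remark 2.4] -/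
theorem isZdGaugeInvariant_sepFam (hΦ : ∀ (H : Fin r → G) (g : G), Φ (fun i => g * H i * g⁻¹) = Φ H) :
    IsZdGaugeInvariant (sepFam Φ d) := by
  intro g U
  unfold sepFam
  simp only [walkHolonomy_gaugeTransformZd]
  exact hΦ _ (g 0)

variable [TopologicalSpace G] [IsTopologicalGroup G]

/-- `sepFam Φ` is continuous for continuous `Φ`. [cite: Levy2004, §2 p.4 (Wilson loops are continuous functions)] -/
theorem continuous_sepFam (hΦ : Continuous Φ) : Continuous (sepFam Φ d) :=
  hΦ.comp (continuous_pi fun _ => continuous_walkHolonomy _)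

omit [IsTopologicalGroup G] in
/-- `sepFam Φ` is bounded for continuous `Φ` on a compact group. [cite: Levy2004, §2 p.4] -/
theorem exists_abs_sepFam_le [CompactSpace G] (hΦ : Continuous Φ) : ∃ C, ∀ U : LGConfig (d + 2) G, |sepFam Φ d U| ≤ C := by
  obtain ⟨C, hC⟩ := isCompact_univ.exists_bound_of_continuousOn hΦ.continuousOn
  exact ⟨C, fun U => by simpa [Real.norm_eq_abs, sepFam] using hC (fun k => walkHolonomy U (loopAt d k)) (Set.mem_univ _)⟩

end Separating

/-! ## §5 THE CRITERION: class-function loop observables span ⟺ word-wise conjugacy forces simultaneous conjugacy -/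

section Criterion

variable {G : Type u} [Group G] [TopologicalSpace G] [IsTopologicalGroup G] [CompactSpace G] [T2Space G]
  [MeasurableSpace G] [BorelSpace G] [SecondCountableTopology G]

omit [TopologicalSpace G] [IsTopologicalGroup G] [CompactSpace G] [T2Space G] [MeasurableSpace G] [BorelSpace G]
  [SecondCountableTopology G] in
/-- The positive word of a list of indices evaluates to the product. [cite: Levy2004, Example 3.3 p.5] -/
private theorem wordVal_map_true {ι : Type*} (l : List ι) (V : ι → G) :
    wordVal (l.map fun i => (i, true)) V = (l.map V).prod := by
  induction l with
  | nil => simp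
  | cons i l ih => simp [ih, letterVal]

/-- **«⟹» (contrapositive): A WORD-WISE CONJUGATE PAIR OF FAMILIES THAT IS NOT SIMULTANEOUSLY CONJUGATE KILLS DENSITY
ON EVERY `ℤ^{d+2}`** — every element of `span_ℝ (classLoopProducts (d+2) G)` agrees on the two test configurations
(§2), while the gauge-invariant continuous bounded cylinder `sepFam Φ` of §§3–4 does not (mechanism of gen 20's
p352515 and gen 21's p354549, now for any compact metrisable `G`). [cite: Levy2004, Prop 3.6 p.5 («Theorem (main) is logically equivalent to … Proposition 3.4»)] -/
theorem not_spansGaugeInvariantCylinders_classLoopProducts_of_not_simConj {r : ℕ} {V W : Fin r → G}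
    (hconj : ∀ w : List (Fin r × Bool), IsConj (wordVal w V) (wordVal w W))
    (hVW : ¬ ∃ g : G, ∀ i, W i = g * V i * g⁻¹) (d : ℕ) :
    ¬ SpansGaugeInvariantCylinders (d + 2) (classLoopProducts (d + 2) G) := by
  obtain ⟨Φ, hΦc, hΦinv, hΦne⟩ := exists_continuous_diagInvariant_apply_ne hVW
  refine not_spansGaugeInvariantCylinders_of_pointFunctional (P := Bool)
    (fun b => if b then cfgN d V else cfgN d W) (fun b => if b then 1 else -1) (fun F hF => ?_)
    (sepFam Φ d) (sepSupport d r) (isCylinder_sepFam Φ) (continuous_sepFam Φ hΦc) (exists_abs_sepFam_le Φ hΦc)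
    (isZdGaugeInvariant_sepFam Φ hΦinv) ?_
  · simp only [pointFunctional, Fintype.sum_bool, if_true, Bool.false_eq_true, if_false, one_mul, neg_one_mul,
      eq_on_cfgN hconj hF, add_neg_cancel]
  · simp only [pointFunctional, Fintype.sum_bool, if_true, Bool.false_eq_true, if_false, one_mul, neg_one_mul,
      sepFam_cfgN]
    exact sub_ne_zero.2 hΦne

/-- **«⟸», STEP: word-wise conjugacy forces simultaneous conjugacy ⟹ the word values of the continuous class
functions separate the simultaneous-conjugation orbits of `G^ι` for every finite `ι`** (file C §1: non-conjugate word
values are told apart by a continuous class function; transport `ι ≃ Fin r`). [cite: Levy2004, Prop 3.4 p.5; Sengupta1994, Thm 2 p.900] -/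
theorem classFamWordsSeparateOrbits_of_wordConj
    (hG : ∀ (r : ℕ) (V W : Fin r → G), (∀ w : List (Fin r × Bool), IsConj (wordVal w V) (wordVal w W)) →
      ∃ g : G, ∀ i, W i = g * V i * g⁻¹)
    (ι : Type) [Fintype ι] (V W : ι → G)
    (h : ∀ (w : List (ι × Bool)) (k : ContClassFun G), classFam G k (wordVal w V) = classFam G k (wordVal w W)) :
    ∃ g : G, ∀ i, W i = g * V i * g⁻¹ := by
  classical
  -- all words are conjugate (else a continuous class function separates them)
  have hconj : ∀ w : List (ι × Bool), IsConj (wordVal w V) (wordVal w W) := fun w => by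
    by_contra hne
    obtain ⟨f, hfc, hfconj, hfne⟩ := exists_continuous_classFun_apply_ne hne
    exact hfne (h w ⟨f, hfc, hfconj⟩)
  -- transport to `Fin (card ι)`
  let e := Fintype.equivFin ι
  obtain ⟨g, hg⟩ := hG (Fintype.card ι) (V ∘ e.symm) (W ∘ e.symm) fun w => by
    have := hconj (w.map fun a => (e.symm a.1, a.2))
    rwa [wordVal_map, wordVal_map] at this
  refine ⟨g, fun i => ?_⟩
  simpa using hg (e i)

/-- **«⟸»: WORD-WISE CONJUGACY FORCES SIMULTANEOUS CONJUGACY ⟹ THE CLASS-FUNCTION LOOP OBSERVABLES SPAN**, in every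
dimension (file A's orbit-Stone–Weierstrass and lasso transport with the family of all continuous class functions).
[cite: Levy2004, Thm 3.1 and Props 3.4–3.6 p.5] -/
theorem spansGaugeInvariantCylinders_classLoopProducts_of_wordConj
    (hG : ∀ (r : ℕ) (V W : Fin r → G), (∀ w : List (Fin r × Bool), IsConj (wordVal w V) (wordVal w W)) →
      ∃ g : G, ∀ i, W i = g * V i * g⁻¹) (d : ℕ) :
    SpansGaugeInvariantCylinders d (classLoopProducts d G) :=
  spansGaugeInvariantCylinders_classLoopProducts_of_separatesOrbits (classFam G) continuous_classFam classFam_conj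
    (classFamWordsSeparateOrbits_of_wordConj hG) d

/-- **HEADLINE — THE CRITERION ([Levy2004] Prop. 3.6 in class-function form, every compact metrisable `G`).**  On the
lattices `ℤ^{d+2}` the real span of the class-function loop products is uniformly dense in the gauge-invariant bounded
continuous cylinder observables for every `d` IF AND ONLY IF every two finite families of elements of `G` whose words
are pairwise conjugate are simultaneously conjugate (Lévy's Prop. 3.4 ∕ Sengupta's Thm 2 as a PROPERTY of `G`; tree:
true for `U(n)`, `SU(n)`, `O(n)`, `SO(2n+1)`, `SO(4)`, abelian groups, products — false for `SO(2m)`, `m ≥ 3`).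
[cite: Levy2004, Prop 3.6 p.5 («Theorem (main) is logically equivalent to its specialization to the graphs L_r, r ≥ 1, which is in turn equivalent to Proposition 3.4»)] -/
theorem spansGaugeInvariantCylinders_classLoopProducts_iff :
    (∀ d : ℕ, SpansGaugeInvariantCylinders (d + 2) (classLoopProducts (d + 2) G)) ↔
      ∀ (r : ℕ) (V W : Fin r → G), (∀ w : List (Fin r × Bool), IsConj (wordVal w V) (wordVal w W)) →
        ∃ g : G, ∀ i, W i = g * V i * g⁻¹ := by
  refine ⟨fun h r V W hconj => ?_, fun hG d => spansGaugeInvariantCylinders_classLoopProducts_of_wordConj hG (d + 2)⟩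
  by_contra hVW
  exact not_spansGaugeInvariantCylinders_classLoopProducts_of_not_simConj hconj hVW 0 (h 0)

omit [TopologicalSpace G] [IsTopologicalGroup G] [CompactSpace G] [T2Space G] [MeasurableSpace G] [BorelSpace G]
  [SecondCountableTopology G] in
/-- [Sengupta1994]'s PROPERTY (conjugacy of all non-empty positive products suffices, tree `ProdConjDetermined`)
implies the word criterion. [cite: Sengupta1994, Thm 2 p.900 («It is only this apparently weaker hypothesis that will be used»)] -/
theorem wordConj_of_prodConjDetermined (hG : ProdConjDetermined.{u, 0} G) (r : ℕ) (V W : Fin r → G)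
    (hconj : ∀ w : List (Fin r × Bool), IsConj (wordVal w V) (wordVal w W)) : ∃ g : G, ∀ i, W i = g * V i * g⁻¹ := by
  refine hG.exists_conj_of_isConj V W fun l _ => ?_
  have h := hconj (l.map fun i => (i, true))
  rwa [wordVal_map_true, wordVal_map_true] at h

end Criterion

end Literature.MathematicalPhysics.QuantumFieldTheory.Balaban1983to89.ClassLoopObservablesDenseIff
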